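import Mathlib
import HarnessLib
import Summits.Ventures.LatticeQCDFlow.Scoring.RegenerativeEstimatorSharp

/-!
# Tours of the split chain, IX: FOURTH MOMENTS — `E[N_i⁴] ≤ 24/ε⁴`, `E[(Y^g_i)⁴] ≤ C_g⁴ · 24/ε⁴` from
# any start (the variance of squared tour sums, for the regenerative variance estimator)

HONEST FRAMING: exact (Metropolis-corrected) sampling algorithms for lattice gauge theory;
figures of merit are autocorrelation/cost numbers at stated couplings and volumes; no
continuum-physics claim.

Venture `LatticeQCDFlow` (cell pub-lqcd), topic `Scoring`; FANOUT row 8 (`s0-cpn-nemc`, GEN-17).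
NEW WORK of the cell, not a published result; no definition is introduced.  Notation of
`Scoring/SplitChainTours.lean`: `K_t` heads among coins `1..t`, `N_i = ∑' u, 1{K_u = i}` the length
of tour `i`, `Y^g_i = ∑' u, 1{K_u = i} g(X_u)`.  `Scoring/SplitChainTourMoments.lean` computed
`E[N_0] = 1/ε`, `E[N_0²] = (2−ε)/ε²` by writing `N_0²` as the weighted occupation `∑' (2u+1) 1{K_u=0}`.
Here the same device one degree up: pathwise `N_0⁴ ≤ 24 ∑' u, C(u+3, 3) · 1{K_u = 0}` once the tour has
ended (`n⁴ ≤ 24 Σ_{u<n} C(u+3,3) = 24 C(n+3,4)`), `E[∑' C(u+3,3) 1{K_u=0}] = Σ_u C(u+3,3)(1−ε)^u = 1/ε⁴`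
(Mathlib's `hasSum_choose_mul_geometric_of_norm_lt_one`), so `E[N_0⁴] ≤ 24/ε⁴` from ANY start; then
`|Y^g_0| ≤ C_g N_0` gives `E[(Y^g_0)⁴] ≤ C_g⁴ · 24/ε⁴`, and the tour theorem transports both bounds to
every later tour.  These are the inputs of the CLT-free consistency certificate for the
regenerative VARIANCE estimator (`Scoring/RegenerativeVarianceEstimator.lean`): the variance of a
squared centred tour sum is at most its fourth moment.  Printed counterpart NAMED ONLY: moment
conditions for regenerative variance estimation (Mykland–Tierney–Yu 1995 §3; Hobert–Jones–Presnell–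
Rosenthal 2002 Thm 2) — nothing is cited as a fact.

## Content (`e = ε.toReal`; `0 < ε < 1`; any initial law; `|g| ≤ C_g` measurable)

* `pow_four_le_sum_choose` — `n⁴ ≤ 24 Σ_{u<n} C(u+3,3)` (via `6 C(u+3,3) = (u+1)(u+2)(u+3)`); `pow_four_tourLength_le_weighted` — the pathwise bound on `N_0⁴`;
* **`splitChain_integral_chooseWeightedTourLength_zero`** — `E[∑' C(u+3,3) 1{K_u=0}] = 1/e⁴`;
* **`splitChain_integral_pow_four_tourLength_zero_le`** — `N_0⁴` integrable, `E[N_0⁴] ≤ 24/e⁴`;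
* **`splitChain_pow_four_tourSum_zero_le`** — `(Y^g_0)⁴` integrable, `E[(Y^g_0)⁴] ≤ C_g⁴ · 24/e⁴`;
* **`splitChain_pow_four_tourSum_le`**, **`splitChain_pow_four_tourLength_le`** — the same for
  tour `i + 1`, every `i` (`E[(Y^g_{i+1})⁴] ≤ C_g⁴ 24/e⁴`, `E[N_{i+1}⁴] ≤ 24/e⁴`).

NOT CLAIMED: the exact value `E[N_0⁴] = (24 − 36ε + 14ε² − ε³)/ε⁴`; any `ε` of a concrete sampler.
-/

noncomputable section

namespace Summit.Ventures.LatticeQCDFlow.Scoring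

open MeasureTheory ProbabilityTheory Filter Finset Preorder Literature.Probability.MarkovChains
open scoped ENNReal

/-! ### Arithmetic and the pathwise bound -/

section Pathwise

variable {Ω : Type*}

/-- `n⁴ ≤ 24 Σ_{u<n} C(u+3, 3)` (the right side is `24 C(n+3, 4) = (n+3)(n+2)(n+1)n ≥ n⁴`; uses
`6 · C(u+3, 3) = (u+1)(u+2)(u+3)`). -/
theorem pow_four_le_sum_choose (n : ℕ) :
    (n : ℝ) ^ 4 ≤ 24 * ∑ u ∈ Finset.range n, (((u + 3).choose 3 : ℕ) : ℝ) := by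
  have hsix : ∀ u : ℕ, 6 * (u + 3).choose 3 = (u + 1) * (u + 2) * (u + 3) := by
    intro u
    have h1 : (u + 3) * (u + 2).choose 2 = (u + 3).choose 3 * 3 := Nat.add_one_mul_choose_eq (u + 2) 2
    have h2 : (u + 2) * (u + 1).choose 1 = (u + 2).choose 2 * 2 := Nat.add_one_mul_choose_eq (u + 1) 1
    rw [Nat.choose_one_right] at h2
    calc 6 * (u + 3).choose 3 = 2 * ((u + 3).choose 3 * 3) := by ring
      _ = 2 * ((u + 3) * (u + 2).choose 2) := by rw [h1]
      _ = (u + 3) * ((u + 2).choose 2 * 2) := by ring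
      _ = (u + 3) * ((u + 2) * (u + 1)) := by rw [← h2]
      _ = (u + 1) * (u + 2) * (u + 3) := by ring
  have hc : ∀ u : ℕ, (6 : ℝ) * (((u + 3).choose 3 : ℕ) : ℝ) = ((u : ℝ) + 1) * ((u : ℝ) + 2) * ((u : ℝ) + 3) := by
    intro u
    have h := hsix u
    exact_mod_cast h
  induction n with
  | zero => simp
  | succ n ih =>
    rw [Finset.sum_range_succ, mul_add]
    have h := hc n
    have hn : (0 : ℝ) ≤ n := n.cast_nonneg
    have h24 : (24 : ℝ) * (((n + 3).choose 3 : ℕ) : ℝ) = 4 * (((n : ℝ) + 1) * ((n : ℝ) + 2) * ((n : ℝ) + 3)) := by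
      rw [← h]; ring
    rw [h24]
    push_cast
    nlinarith [ih, hn, sq_nonneg (n : ℝ), mul_nonneg hn (sq_nonneg (n : ℝ))]

/-- **`N_0⁴ ≤ 24 ∑' u, C(u+3,3) · 1{K_u = 0}` once tour `0` has ended** (first head at `t + 1`: the left
side is `(t+1)⁴`, the right side `24 C(t+4, 4)`). -/
theorem pow_four_tourLength_le_weighted (x : ℕ → Ω × Bool) {t : ℕ}
    (ht : (∑ s ∈ Finset.range t, (if (x (s + 1)).2 then (1 : ℕ) else 0)) = 0)
    (hh : (x (t + 1)).2 = true) :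
    (∑' u, (if (∑ s ∈ Finset.range u, (if (x (s + 1)).2 then (1 : ℕ) else 0)) = 0
        then (1 : ℝ) else 0)) ^ 4
      ≤ 24 * ∑' u : ℕ, (((u + 3).choose 3 : ℕ) : ℝ) * (if (∑ s ∈ Finset.range u,
        (if (x (s + 1)).2 then (1 : ℕ) else 0)) = 0 then (1 : ℝ) else 0) := by
  -- `K_u = 0` iff `u ≤ t`
  have hK : ∀ u, ((∑ s ∈ Finset.range u, (if (x (s + 1)).2 then (1 : ℕ) else 0)) = 0) ↔ u ≤ t := by
    intro u
    constructor
    · intro hu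
      by_contra h
      have := headCount_pos_of_tourStart x ht hh (show t + 1 ≤ u by omega)
      omega
    · intro hu
      have := headCount_mono x hu
      omega
  have hz1 : ∀ u ∉ Finset.range (t + 1), (if (∑ s ∈ Finset.range u,
      (if (x (s + 1)).2 then (1 : ℕ) else 0)) = 0 then (1 : ℝ) else 0) = 0 := fun u hu => by
    rw [if_neg ((hK u).not.2 (by have := Finset.mem_range.not.1 hu; omega))]
  have hz2 : ∀ u ∉ Finset.range (t + 1), (((u + 3).choose 3 : ℕ) : ℝ) * (if (∑ s ∈ Finset.range u,
      (if (x (s + 1)).2 then (1 : ℕ) else 0)) = 0 then (1 : ℝ) else 0) = 0 := fun u hu => by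
    rw [hz1 u hu, mul_zero]
  have h1 : ∑' u, (if (∑ s ∈ Finset.range u, (if (x (s + 1)).2 then (1 : ℕ) else 0)) = 0
      then (1 : ℝ) else 0) = ∑ u ∈ Finset.range (t + 1), (1 : ℝ) := by
    rw [tsum_eq_sum hz1]
    exact Finset.sum_congr rfl fun u hu => by
      rw [if_pos ((hK u).2 (by have := Finset.mem_range.1 hu; omega))]
  have h2 : ∑' u : ℕ, (((u + 3).choose 3 : ℕ) : ℝ) * (if (∑ s ∈ Finset.range u,
      (if (x (s + 1)).2 then (1 : ℕ) else 0)) = 0 then (1 : ℝ) else 0)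
      = ∑ u ∈ Finset.range (t + 1), (((u + 3).choose 3 : ℕ) : ℝ) := by
    rw [tsum_eq_sum hz2]
    exact Finset.sum_congr rfl fun u hu => by
      rw [if_pos ((hK u).2 (by have := Finset.mem_range.1 hu; omega)), mul_one]
  rw [h1, h2, Finset.sum_const, Finset.card_range, nsmul_eq_mul, mul_one]
  exact pow_four_le_sum_choose (t + 1)

end Pathwise

/-! ### Fourth moments from any start -/

section Moments

variable {Ω : Type*} [MeasurableSpace Ω]
  {κ : Kernel Ω Ω} [IsMarkovKernel κ] {ν : Measure Ω} [IsProbabilityMeasure ν] {ε : ℝ≥0∞}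
  {hmin : ∀ x {B : Set Ω}, MeasurableSet B → ε * ν B ≤ κ x B}
  (κs : Kernel (Ω × Bool) (Ω × Bool)) [IsMarkovKernel κs]
  (μs : Measure (Ω × Bool)) [IsProbabilityMeasure μs]

/-- **`E[∑' u, C(u+3,3) · 1{K_u = 0}] = 1/e⁴` from any start** (integrable): `E[1{K_u = 0}] = (1−e)^u`
and `Σ_u C(u+3,3) r^u = 1/(1−r)⁴`. -/
theorem splitChain_integral_chooseWeightedTourLength_zero (hε0 : 0 < ε) (hε : ε < 1)
    (hκs : ∀ p, κs p = (ε • ν).map (fun y : Ω => (y, true))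
      + ((1 - ε) • Doeblin.residualKernel κ ν ε hmin p.1).map (fun y : Ω => (y, false))) :
    Integrable (fun x : ℕ → Ω × Bool => ∑' u : ℕ, (((u + 3).choose 3 : ℕ) : ℝ) * (if (∑ s ∈ Finset.range u,
        (if (x (s + 1)).2 then (1 : ℕ) else 0)) = 0 then (1 : ℝ) else 0))
      (Kernel.trajMeasure (X := fun _ : ℕ => Ω × Bool) μs
        (fun n : ℕ => κs.comap (fun h : (i : ↥(Finset.Iic n)) → Ω × Bool =>
          h ⟨n, Finset.mem_Iic.2 le_rfl⟩) (measurable_pi_apply _)))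
    ∧ ∫ x, ∑' u : ℕ, (((u + 3).choose 3 : ℕ) : ℝ) * (if (∑ s ∈ Finset.range u,
        (if (x (s + 1)).2 then (1 : ℕ) else 0)) = 0 then (1 : ℝ) else 0)
        ∂(Kernel.trajMeasure (X := fun _ : ℕ => Ω × Bool) μs
          (fun n : ℕ => κs.comap (fun h : (i : ↥(Finset.Iic n)) → Ω × Bool =>
            h ⟨n, Finset.mem_Iic.2 le_rfl⟩) (measurable_pi_apply _)))
      = 1 / ε.toReal ^ 4 := by
  set P := Kernel.trajMeasure (X := fun _ : ℕ => Ω × Bool) μs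
      (fun n : ℕ => κs.comap (fun h : (i : ↥(Finset.Iic n)) → Ω × Bool =>
        h ⟨n, Finset.mem_Iic.2 le_rfl⟩) (measurable_pi_apply _)) with hP
  have he0 : 0 < ε.toReal := ENNReal.toReal_pos hε0.ne' (ne_top_of_lt hε)
  have he1 : ε.toReal ≤ 1 := by
    have := (ENNReal.toReal_lt_toReal (ne_top_of_lt hε) ENNReal.one_ne_top).2 hε
    rw [ENNReal.toReal_one] at this
    exact this.le
  have hterm : ∀ u : ℕ, ∫ x, (((u + 3).choose 3 : ℕ) : ℝ) * (if (∑ s ∈ Finset.range u,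
      (if (x (s + 1)).2 then (1 : ℕ) else 0)) = 0 then (1 : ℝ) else 0) ∂P
      = (((u + 3).choose 3 : ℕ) : ℝ) * (1 - ε.toReal) ^ u := by
    intro u
    rw [integral_const_mul]
    congr 1
    simp_rw [headCount_eq_zero_indicator]
    have h := splitChain_tailsRun κs μs (κ := κ) (ν := ν) (hmin := hmin) hε hκs 0
      (G := fun _ => (1 : ℝ)) measurable_const (fun _ _ _ => rfl) (CG := 1) (fun _ => by simp) u
    simp only [one_mul, Nat.zero_add, integral_const, probReal_univ, one_smul, mul_one] at h
    rw [hP]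
    exact h
  have hu0 : ∀ u : ℕ, (0 : ℝ) ≤ (((u + 3).choose 3 : ℕ) : ℝ) := fun u => Nat.cast_nonneg _
  have hint : ∀ u : ℕ, Integrable (fun x : ℕ → Ω × Bool => (((u + 3).choose 3 : ℕ) : ℝ) * (if (∑ s ∈ Finset.range u,
      (if (x (s + 1)).2 then (1 : ℕ) else 0)) = 0 then (1 : ℝ) else 0)) P := fun u =>
    integrable_of_bounded P (measurable_const.mul (measurable_headCountIndicator u 0))
      (C := (((u + 3).choose 3 : ℕ) : ℝ) * 1) fun x => by
      rw [abs_mul, abs_of_nonneg (hu0 u)]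
      refine mul_le_mul_of_nonneg_left ?_ (hu0 u)
      split_ifs <;> simp
  have hnorm : ∀ u : ℕ, ∫ x, ‖(((u + 3).choose 3 : ℕ) : ℝ) * (if (∑ s ∈ Finset.range u,
      (if (x (s + 1)).2 then (1 : ℕ) else 0)) = 0 then (1 : ℝ) else 0)‖ ∂P
      = (((u + 3).choose 3 : ℕ) : ℝ) * (1 - ε.toReal) ^ u := fun u => by
    rw [← hterm u]
    exact integral_congr_ae (ae_of_all _ fun x => by
      beta_reduce
      rw [Real.norm_eq_abs, abs_of_nonneg (mul_nonneg (hu0 u) (by split_ifs <;> norm_num))])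
  -- `Σ C(u+3,3) r^u = 1/(1-r)⁴` with `r = 1 - e`
  have hr : ‖(1 - ε.toReal)‖ < 1 := by rw [Real.norm_eq_abs, abs_of_nonneg (by linarith)]; linarith
  have hS : HasSum (fun u : ℕ => (((u + 3).choose 3 : ℕ) : ℝ) * (1 - ε.toReal) ^ u) (1 / ε.toReal ^ 4) := by
    have h := hasSum_choose_mul_geometric_of_norm_lt_one 3 hr
    rw [sub_sub_cancel] at h
    exact h
  have hsum : Summable fun u : ℕ => ∫ x, ‖(((u + 3).choose 3 : ℕ) : ℝ) * (if (∑ s ∈ Finset.range u,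
      (if (x (s + 1)).2 then (1 : ℕ) else 0)) = 0 then (1 : ℝ) else 0)‖ ∂P := by
    simp_rw [hnorm]; exact hS.summable
  refine ⟨integrable_tsum_of_summable_integral_norm P hint hsum, ?_⟩
  rw [← integral_tsum_of_summable_integral_norm hint hsum]
  simp_rw [hterm]
  exact hS.tsum_eq

/-- **`E[N_0⁴] ≤ 24/e⁴` from any start** (`0 < ε < 1`; `N_0⁴` integrable). -/
theorem splitChain_integral_pow_four_tourLength_zero_le (hε0 : 0 < ε) (hε : ε < 1)
    (hκs : ∀ p, κs p = (ε • ν).map (fun y : Ω => (y, true))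
      + ((1 - ε) • Doeblin.residualKernel κ ν ε hmin p.1).map (fun y : Ω => (y, false))) :
    Integrable (fun x : ℕ → Ω × Bool => (∑' u, (if (∑ s ∈ Finset.range u,
        (if (x (s + 1)).2 then (1 : ℕ) else 0)) = 0 then (1 : ℝ) else 0)) ^ 4)
      (Kernel.trajMeasure (X := fun _ : ℕ => Ω × Bool) μs
        (fun n : ℕ => κs.comap (fun h : (i : ↥(Finset.Iic n)) → Ω × Bool =>
          h ⟨n, Finset.mem_Iic.2 le_rfl⟩) (measurable_pi_apply _)))
    ∧ ∫ x, (∑' u, (if (∑ s ∈ Finset.range u, (if (x (s + 1)).2 then (1 : ℕ) else 0)) = 0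
        then (1 : ℝ) else 0)) ^ 4
        ∂(Kernel.trajMeasure (X := fun _ : ℕ => Ω × Bool) μs
          (fun n : ℕ => κs.comap (fun h : (i : ↥(Finset.Iic n)) → Ω × Bool =>
            h ⟨n, Finset.mem_Iic.2 le_rfl⟩) (measurable_pi_apply _)))
      ≤ 24 / ε.toReal ^ 4 := by
  set P := Kernel.trajMeasure (X := fun _ : ℕ => Ω × Bool) μs
      (fun n : ℕ => κs.comap (fun h : (i : ↥(Finset.Iic n)) → Ω × Bool =>
        h ⟨n, Finset.mem_Iic.2 le_rfl⟩) (measurable_pi_apply _)) with hP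
  obtain ⟨hI, hE⟩ := splitChain_integral_chooseWeightedTourLength_zero κs μs (κ := κ) (ν := ν)
    (hmin := hmin) hε0 hε hκs
  rw [← hP] at hI hE
  have hNm : Measurable fun x : ℕ → Ω × Bool => (∑' u, (if (∑ s ∈ Finset.range u,
      (if (x (s + 1)).2 then (1 : ℕ) else 0)) = 0 then (1 : ℝ) else 0)) ^ 4 :=
    (Measurable.tsum fun u => measurable_headCountIndicator u 0).pow_const 4
  have hae : ∀ᵐ x ∂P, ‖(∑' u, (if (∑ s ∈ Finset.range u, (if (x (s + 1)).2 then (1 : ℕ) else 0)) = 0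
      then (1 : ℝ) else 0)) ^ 4‖
      ≤ 24 * ∑' u : ℕ, (((u + 3).choose 3 : ℕ) : ℝ) * (if (∑ s ∈ Finset.range u,
        (if (x (s + 1)).2 then (1 : ℕ) else 0)) = 0 then (1 : ℝ) else 0) := by
    filter_upwards [splitChain_ae_tourStart κs μs (κ := κ) (ν := ν) (hmin := hmin) hε0 hε hκs]
      with x hx
    obtain ⟨t, ht, hh⟩ := hx 0
    rw [Real.norm_eq_abs, abs_of_nonneg (by positivity)]
    exact pow_four_tourLength_le_weighted x ht hh
  have hint : Integrable (fun x : ℕ → Ω × Bool => (∑' u, (if (∑ s ∈ Finset.range u,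
      (if (x (s + 1)).2 then (1 : ℕ) else 0)) = 0 then (1 : ℝ) else 0)) ^ 4) P :=
    Integrable.mono' (hI.const_mul 24) hNm.aestronglyMeasurable hae
  refine ⟨hint, ?_⟩
  calc _ ≤ ∫ x, 24 * ∑' u : ℕ, (((u + 3).choose 3 : ℕ) : ℝ) * (if (∑ s ∈ Finset.range u,
        (if (x (s + 1)).2 then (1 : ℕ) else 0)) = 0 then (1 : ℝ) else 0) ∂P := by
        refine integral_mono_ae hint (hI.const_mul 24) ?_
        filter_upwards [hae] with x hx
        rw [Real.norm_eq_abs, abs_of_nonneg (by positivity)] at hx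
        exact hx
    _ = 24 / ε.toReal ^ 4 := by rw [integral_const_mul, hE]; ring

/-- **Fourth moment of a tour sum**: for `|g| ≤ C_g` measurable, `(Y^g_0)⁴` is integrable from any
start and `E[(Y^g_0)⁴] ≤ C_g⁴ · 24/e⁴` (since `|Y^g_0| ≤ C_g N_0` almost surely). -/
theorem splitChain_pow_four_tourSum_zero_le (hε0 : 0 < ε) (hε : ε < 1)
    (hκs : ∀ p, κs p = (ε • ν).map (fun y : Ω => (y, true))
      + ((1 - ε) • Doeblin.residualKernel κ ν ε hmin p.1).map (fun y : Ω => (y, false)))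
    {g : Ω → ℝ} (hg : Measurable g) {Cg : ℝ} (hCg : ∀ x, |g x| ≤ Cg) :
    Integrable (fun x : ℕ → Ω × Bool => (∑' u, (if (∑ s ∈ Finset.range u,
        (if (x (s + 1)).2 then (1 : ℕ) else 0)) = 0 then (1 : ℝ) else 0) * g (x u).1) ^ 4)
      (Kernel.trajMeasure (X := fun _ : ℕ => Ω × Bool) μs
        (fun n : ℕ => κs.comap (fun h : (i : ↥(Finset.Iic n)) → Ω × Bool =>
          h ⟨n, Finset.mem_Iic.2 le_rfl⟩) (measurable_pi_apply _)))
    ∧ ∫ x, (∑' u, (if (∑ s ∈ Finset.range u, (if (x (s + 1)).2 then (1 : ℕ) else 0)) = 0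
        then (1 : ℝ) else 0) * g (x u).1) ^ 4
        ∂(Kernel.trajMeasure (X := fun _ : ℕ => Ω × Bool) μs
          (fun n : ℕ => κs.comap (fun h : (i : ↥(Finset.Iic n)) → Ω × Bool =>
            h ⟨n, Finset.mem_Iic.2 le_rfl⟩) (measurable_pi_apply _)))
      ≤ Cg ^ 4 * (24 / ε.toReal ^ 4) := by
  set P := Kernel.trajMeasure (X := fun _ : ℕ => Ω × Bool) μs
      (fun n : ℕ => κs.comap (fun h : (i : ↥(Finset.Iic n)) → Ω × Bool =>
        h ⟨n, Finset.mem_Iic.2 le_rfl⟩) (measurable_pi_apply _)) with hP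
  obtain ⟨hI, hE⟩ := splitChain_integral_pow_four_tourLength_zero_le κs μs (κ := κ) (ν := ν)
    (hmin := hmin) hε0 hε hκs
  rw [← hP] at hI hE
  have hψ : Measurable fun pq : (Ω × Bool) × (Ω × Bool) => g pq.1.1 :=
    hg.comp (measurable_fst.comp measurable_fst)
  have hYm := (measurable_tourSum (Ω := Ω) (ψ := fun p _ => g p.1) hψ 0).pow_const 4
  have hae : ∀ᵐ x ∂P, ‖(∑' u, (if (∑ s ∈ Finset.range u, (if (x (s + 1)).2 then (1 : ℕ) else 0)) = 0
      then (1 : ℝ) else 0) * g (x u).1) ^ 4‖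
      ≤ Cg ^ 4 * (∑' u, (if (∑ s ∈ Finset.range u, (if (x (s + 1)).2 then (1 : ℕ) else 0)) = 0
        then (1 : ℝ) else 0)) ^ 4 := by
    filter_upwards [splitChain_ae_tourStart κs μs (κ := κ) (ν := ν) (hmin := hmin) hε0 hε hκs]
      with x hx
    obtain ⟨t, ht, hh⟩ := hx 0
    have hb := abs_tourSum_le_tourLength (ψ := fun p _ => g p.1) (fun p _ => hCg p.1) x le_rfl ht hh
    rw [Real.norm_eq_abs, abs_pow, ← mul_pow]
    exact pow_le_pow_left₀ (abs_nonneg _) hb 4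
  refine ⟨Integrable.mono' (hI.const_mul (Cg ^ 4)) hYm.aestronglyMeasurable hae, ?_⟩
  calc ∫ x, (∑' u, (if (∑ s ∈ Finset.range u, (if (x (s + 1)).2 then (1 : ℕ) else 0)) = 0
        then (1 : ℝ) else 0) * g (x u).1) ^ 4 ∂P
      ≤ ∫ x, Cg ^ 4 * (∑' u, (if (∑ s ∈ Finset.range u, (if (x (s + 1)).2 then (1 : ℕ) else 0)) = 0
        then (1 : ℝ) else 0)) ^ 4 ∂P := by
        refine integral_mono_ae (Integrable.mono' (hI.const_mul (Cg ^ 4)) hYm.aestronglyMeasurable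
          hae) (hI.const_mul (Cg ^ 4)) ?_
        filter_upwards [hae] with x hx
        rw [Real.norm_eq_abs, abs_of_nonneg (by positivity)] at hx
        exact hx
    _ ≤ Cg ^ 4 * (24 / ε.toReal ^ 4) := by
        rw [integral_const_mul]
        exact mul_le_mul_of_nonneg_left hE (by positivity)

/-- **Fourth moment of ANY tour sum**: for every `i`, `(Y^g_{i+1})⁴` is integrable from any start and
`E[(Y^g_{i+1})⁴] ≤ C_g⁴ · 24/e⁴` (tour `i + 1` is distributed as tour `0` of a fresh run). -/
theorem splitChain_pow_four_tourSum_le (hε0 : 0 < ε) (hε : ε < 1)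
    (hκs : ∀ p, κs p = (ε • ν).map (fun y : Ω => (y, true))
      + ((1 - ε) • Doeblin.residualKernel κ ν ε hmin p.1).map (fun y : Ω => (y, false)))
    {g : Ω → ℝ} (hg : Measurable g) {Cg : ℝ} (hCg : ∀ x, |g x| ≤ Cg) (i : ℕ) :
    Integrable (fun x : ℕ → Ω × Bool => (∑' u, (if (∑ s ∈ Finset.range u,
        (if (x (s + 1)).2 then (1 : ℕ) else 0)) = i + 1 then (1 : ℝ) else 0) * g (x u).1) ^ 4)
      (Kernel.trajMeasure (X := fun _ : ℕ => Ω × Bool) μs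
        (fun n : ℕ => κs.comap (fun h : (i : ↥(Finset.Iic n)) → Ω × Bool =>
          h ⟨n, Finset.mem_Iic.2 le_rfl⟩) (measurable_pi_apply _)))
    ∧ ∫ x, (∑' u, (if (∑ s ∈ Finset.range u, (if (x (s + 1)).2 then (1 : ℕ) else 0)) = i + 1
        then (1 : ℝ) else 0) * g (x u).1) ^ 4
        ∂(Kernel.trajMeasure (X := fun _ : ℕ => Ω × Bool) μs
          (fun n : ℕ => κs.comap (fun h : (i : ↥(Finset.Iic n)) → Ω × Bool =>
            h ⟨n, Finset.mem_Iic.2 le_rfl⟩) (measurable_pi_apply _)))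
      ≤ Cg ^ 4 * (24 / ε.toReal ^ 4) := by
  haveI hνt : IsProbabilityMeasure (ν.map (fun y : Ω => (y, true))) :=
    Measure.isProbabilityMeasure_map (measurable_tagCoin true).aemeasurable
  obtain ⟨h0I, h0E⟩ := splitChain_pow_four_tourSum_zero_le κs (ν.map (fun y : Ω => (y, true)))
    (κ := κ) (ν := ν) (hmin := hmin) hε0 hε hκs hg hCg
  have hψ : Measurable fun pq : (Ω × Bool) × (Ω × Bool) => g pq.1.1 :=
    hg.comp (measurable_fst.comp measurable_fst)
  have hI := splitChain_tourFunctional_integrable κs μs (κ := κ) (ν := ν) (hmin := hmin) hε hκs i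
    (ψ₁ := fun p _ => g p.1) (ψ₂ := fun p _ => g p.1) hψ hψ (Λ := fun a _ => a ^ 4)
    (by norm_num) ((measurable_fst (α := ℝ) (β := ℝ)).pow_const 4) h0I
  have hE := splitChain_tour_identically_distributed κs μs (κ := κ) (ν := ν) (hmin := hmin) hε0 hε
    hκs i (ψ₁ := fun p _ => g p.1) (ψ₂ := fun p _ => g p.1) hψ hψ (Λ := fun a _ => a ^ 4)
    (by norm_num) ((measurable_fst (α := ℝ) (β := ℝ)).pow_const 4) h0I
  exact ⟨hI, hE.trans_le h0E⟩

/-- **Fourth moment of ANY tour length**: `N_{i+1}⁴` is integrable from any start and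
`E[N_{i+1}⁴] ≤ 24/e⁴`. -/
theorem splitChain_pow_four_tourLength_le (hε0 : 0 < ε) (hε : ε < 1)
    (hκs : ∀ p, κs p = (ε • ν).map (fun y : Ω => (y, true))
      + ((1 - ε) • Doeblin.residualKernel κ ν ε hmin p.1).map (fun y : Ω => (y, false)))
    (i : ℕ) :
    Integrable (fun x : ℕ → Ω × Bool => (∑' u, (if (∑ s ∈ Finset.range u,
        (if (x (s + 1)).2 then (1 : ℕ) else 0)) = i + 1 then (1 : ℝ) else 0)) ^ 4)
      (Kernel.trajMeasure (X := fun _ : ℕ => Ω × Bool) μs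
        (fun n : ℕ => κs.comap (fun h : (i : ↥(Finset.Iic n)) → Ω × Bool =>
          h ⟨n, Finset.mem_Iic.2 le_rfl⟩) (measurable_pi_apply _)))
    ∧ ∫ x, (∑' u, (if (∑ s ∈ Finset.range u, (if (x (s + 1)).2 then (1 : ℕ) else 0)) = i + 1
        then (1 : ℝ) else 0)) ^ 4
        ∂(Kernel.trajMeasure (X := fun _ : ℕ => Ω × Bool) μs
          (fun n : ℕ => κs.comap (fun h : (i : ↥(Finset.Iic n)) → Ω × Bool =>
            h ⟨n, Finset.mem_Iic.2 le_rfl⟩) (measurable_pi_apply _)))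
      ≤ 24 / ε.toReal ^ 4 := by
  obtain ⟨hI, hE⟩ := splitChain_pow_four_tourSum_le κs μs (κ := κ) (ν := ν) (hmin := hmin) hε0 hε
    hκs (g := fun _ => (1 : ℝ)) measurable_const (Cg := 1) (fun _ => by simp) i
  have hbr : ∀ (y : ℕ → Ω × Bool), (∑' u, (if (∑ s ∈ Finset.range u,
      (if (y (s + 1)).2 then (1 : ℕ) else 0)) = i + 1 then (1 : ℝ) else 0) * (1 : ℝ))
      = ∑' u, (if (∑ s ∈ Finset.range u, (if (y (s + 1)).2 then (1 : ℕ) else 0)) = i + 1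
        then (1 : ℝ) else 0) := fun y => tsum_congr fun u => mul_one _
  simp only [hbr, one_pow, one_mul] at hI hE
  exact ⟨hI, hE⟩

end Moments

end Summit.Ventures.LatticeQCDFlow.Scoring

end
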